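import Summits.ValiantsHypothesis.ValiantsHypothesis.Theorems.NewtonUnitEquationsTwoProductsRankOneThreeLawLaw
import HarnessLib

/-!
# Route NewtonUnitEquations — crux `TwoProducts` (stmt-ValiantsHypothesis-5906), line `relation_ladder`, rung R6c (three-term
# rank one, arithmetic-progression shape `2β = α + γ`): the VERONESE LIFT — part 1/5 — the Veronese substitution, balanced exponents, fibres and the multinomial regrouping (Parts V1–V2)

val-lit-p3 g15 (prover seat, helper mode `--supports stmt-ValiantsHypothesis-5906 --as helper`), 2026-08-28.  Rung R6c of val-idea-8's line
`relation_ladder` (card `Lines/relation_ladder.md` v14 l.28–35; engine memo `Lines/relation_ladder_R6_engine.md` rev 3 §7′: «`2β = α + γ` (3-AP,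
`ρ⁺ = {β,β}`): Veronese `X_α ↦ Z², X_β ↦ ZW, X_γ ↦ W²` after DOUBLING all planar exponents»).  THE THREE-TERM ARITHMETIC-PROGRESSION RANK-ONE
LAW: if ALL additive coincidences of the letter family `A_j = supp u_j ∪ supp v_j` come from ONE relation `α + γ = β + β` among DISTINCT
letters (`RankOneCoincidences A (2·e_β) (e_α + e_γ)`), then GLOBALLY `#visible ≤ 2^{c m} (#T + 2)^c` — the statement shape of R3♯
`permTypeLaw_proof` / R6 `rankOneFourLaw_proof` / R6b `R6b.rankOneThreeLaw_proof`.  MECHANISM: the VERONESE LIFT realises the toric ring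
`ℂ[Y]/(Y_β² − Y_αY_γ)` inside a FREE ring (variables `Z = Y_a`, `W = Y_c`, `Y_b` dead); the planar push-forward `Z ↦ α, W ↦ γ, Y_e ↦ 2e`
DOUBLES every planar exponent INSIDE the push-forward (`phi E' ∘ φ_ver = doubling ∘ phi enum`), so the instance `(u, v)` is never changed and
`ℕ²`-integrality is automatic; rank-one coincidences = injectivity on the lifted support (one level up from R3♯'s `injOn_of_permType`); Lemma A
upstairs = the tree's `toric_minLog`; the fibre of the lift over a balanced exponent is `{#β = k : k ≡ x_Z (mod 2), k ≤ min(x_Z, x_W)}` with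
CONSTANT letter count, and the multinomial regroups as `multinomial(x̂)·C(h,(x_W+k)/2)·C((x_W+k)/2,k)` in the HALF-DEGREE `h = (x_Z+x_W)/2` —
so with the reduced exponent `x̂ = (h @ Z, 0 @ Y_b, 0 @ W, rest)` every slice `b = x_W ≤ 2m` is a plain BINOMIAL-EXPONENTIAL sum of width
`≤ 2m(2m+1)²` (no parity bases, no square roots), counted by val-lit-p3 g14's tool `BinExpSum.binExpPencilCount` (p620797) through the landed
`binExpPencilCount_fintype`; the slice identity `θ(x) = 2·Σ_i (−wt ξ ŝ_i) x̂_i + (Γ − A)·x_W` makes the slice functional affine along the pencil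
of valid weights; degenerate case (a relation letter outside the alphabet) via R3♯.  All statements are by LITERAL body (no parameter-free
`def … : Prop`); generic toolkit (`phiT/piT`, `binChar/bsum/bwidth`, `toric_minLog`, `RankOneCoincidences`, `idxOf`, `rW`, `lwt_*`, `SIdx/tab/sgn`)
and the three-index API (`R6b.ThreeIdx`, `R6b.rest`, `R6b.prod_three_split`, …) are IMPORTED from the landed R6 / R6b ports, not re-declared.
Honest scope: helper layer; nothing here closes the residual of the line, the crux `TwoProducts` (5906) or `VP ≠ VNP`; no summit statement is
proved. [folklore]
-/

noncomputable section

-- Sub = Summit single-conjunct layout: the duplicated namespace component is mandated by the tree.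
set_option linter.dupNamespace false
set_option linter.unusedSimpArgs false

namespace Summit.ValiantsHypothesis.ValiantsHypothesis.Theorems.NewtonUnitEquations.TwoProducts.PermutationType
namespace R6c
open scoped BigOperators
open MvPolynomial

variable {σ : Type*} [Fintype σ] [DecidableEq σ]

variable (J : R6b.ThreeIdx σ)

/-! ## Part V1: the three-term relation data and the Veronese substitution
`α ↦ Y_a²`, `β ↦ Y_a Y_c`, `γ ↦ Y_c²`, other letters unchanged -/

variable (J : R6b.ThreeIdx σ)

/-- The Veronese substitution on letters: `Y_a ↦ Y_a²`, `Y_b ↦ Y_a Y_c`, `Y_c ↦ Y_c²`, `Y_i ↦ Y_i` otherwise. [folklore] -/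
def verM (i : σ) : σ →₀ ℕ :=
  if i = J.a then Finsupp.single J.a 2
  else if i = J.b then Finsupp.single J.a 1 + Finsupp.single J.c 1
  else if i = J.c then Finsupp.single J.c 2
  else Finsupp.single i 1

omit [Fintype σ] in
/-- The Veronese substitution at `α`. [folklore] -/
theorem verM_a : verM J J.a = Finsupp.single J.a 2 := by
  unfold verM; rw [if_pos rfl]

omit [Fintype σ] in
/-- The Veronese substitution at `β`. [folklore] -/
theorem verM_b : verM J J.b = Finsupp.single J.a 1 + Finsupp.single J.c 1 := by
  unfold verM; rw [if_neg J.hab.symm, if_pos rfl]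

omit [Fintype σ] in
/-- The Veronese substitution at `γ`. [folklore] -/
theorem verM_c : verM J J.c = Finsupp.single J.c 2 := by
  unfold verM; rw [if_neg J.hac.symm, if_neg J.hbc.symm, if_pos rfl]

omit [Fintype σ] in
/-- The Veronese substitution elsewhere. [folklore] -/
theorem verM_other (i : σ) (ha : i ≠ J.a) (hb : i ≠ J.b) (hc : i ≠ J.c) : verM J i = Finsupp.single i 1 := by
  unfold verM; rw [if_neg ha, if_neg hb, if_neg hc]

omit [Fintype σ] in
/-- The Veronese substitution identifies the two sides of the relation: `M α + M γ = M β + M β`. [folklore] -/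
theorem verM_rel : verM J J.a + verM J J.c = verM J J.b + verM J J.b := by
  rw [verM_a, verM_b, verM_c]
  ext j
  simp only [Finsupp.add_apply, Finsupp.single_apply]
  split_ifs <;> omega

omit [Fintype σ] in
/-- Every `verM i` is nonzero. [folklore] -/
theorem verM_ne_zero (i : σ) : verM J i ≠ 0 := by
  unfold verM
  split_ifs <;> intro h
  · have := DFunLike.congr_fun h J.a; simp at this
  · have := DFunLike.congr_fun h J.a; simp [J.hac] at this
  · have := DFunLike.congr_fun h J.c; simp at this
  · have := DFunLike.congr_fun h i; simp at this

/-- `Z`-coordinate of a Veronese image: `2 #α + #β`. [folklore] -/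
theorem piT_verM_a (L : σ →₀ ℕ) : piT (verM J) L J.a = 2 * L J.a + L J.b := by
  have F := And.intro J.hab (And.intro J.hac J.hbc)
  rw [piT_apply]
  have key : ∀ i, L i * (verM J i) J.a = (if i = J.a then 2 * L i else 0) + (if i = J.b then L i else 0) := by
    intro i
    by_cases h1 : i = J.a
    · subst h1; rw [verM_a]; simp [Finsupp.single_apply, F.1]; ring
    by_cases h2 : i = J.b
    · subst h2; rw [verM_b]; simp [Finsupp.single_apply, F.1.symm, F.2.1.symm]
    by_cases h3 : i = J.c
    · subst h3; rw [verM_c]; simp [Finsupp.single_apply, F.2.1.symm, F.2.2.symm]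
    rw [verM_other J i h1 h2 h3]; simp [Finsupp.single_apply, h1, h2]
  simp only [key, Finset.sum_add_distrib, Finset.sum_ite_eq', Finset.mem_univ, if_true]

/-- The `Y_b`-coordinate of a Veronese image vanishes. [folklore] -/
theorem piT_verM_b (L : σ →₀ ℕ) : piT (verM J) L J.b = 0 := by
  have F := And.intro J.hab (And.intro J.hac J.hbc)
  rw [piT_apply]
  refine Finset.sum_eq_zero fun i _ => ?_
  by_cases h1 : i = J.a
  · subst h1; rw [verM_a]; simp [Finsupp.single_apply, F.1]
  by_cases h2 : i = J.b
  · subst h2; rw [verM_b]; simp [Finsupp.single_apply, F.1, F.2.2.symm]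
  by_cases h3 : i = J.c
  · subst h3; rw [verM_c]; simp [Finsupp.single_apply, F.2.2.symm]
  rw [verM_other J i h1 h2 h3]; simp [Finsupp.single_apply, h2]

/-- `W`-coordinate of a Veronese image: `#β + 2 #γ`. [folklore] -/
theorem piT_verM_c (L : σ →₀ ℕ) : piT (verM J) L J.c = L J.b + 2 * L J.c := by
  have F := And.intro J.hab (And.intro J.hac J.hbc)
  rw [piT_apply]
  have key : ∀ i, L i * (verM J i) J.c = (if i = J.b then L i else 0) + (if i = J.c then 2 * L i else 0) := by
    intro i
    by_cases h1 : i = J.a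
    · subst h1; rw [verM_a]; simp [Finsupp.single_apply, F.1, F.2.1]
    by_cases h2 : i = J.b
    · subst h2; rw [verM_b]; simp [Finsupp.single_apply, F.2.1, F.2.2]
    by_cases h3 : i = J.c
    · subst h3; rw [verM_c]; simp [Finsupp.single_apply, F.2.2.symm]; ring
    rw [verM_other J i h1 h2 h3]; simp [Finsupp.single_apply, h2, h3]
  simp only [key, Finset.sum_add_distrib, Finset.sum_ite_eq', Finset.mem_univ, if_true]

/-- Other coordinates of a Veronese image are unchanged. [folklore] -/
theorem piT_verM_other (L : σ →₀ ℕ) (j : σ) (ha : j ≠ J.a) (hb : j ≠ J.b) (hc : j ≠ J.c) :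
    piT (verM J) L j = L j := by
  have F := And.intro J.hab (And.intro J.hac J.hbc)
  rw [piT_apply]
  have key : ∀ i, L i * (verM J i) j = (if i = j then L i else 0) := by
    intro i
    by_cases h1 : i = J.a
    · subst h1; rw [verM_a]; simp [Finsupp.single_apply, Ne.symm ha]
    by_cases h2 : i = J.b
    · subst h2; rw [verM_b]; simp [Finsupp.single_apply, Ne.symm ha, Ne.symm hb, Ne.symm hc]
    by_cases h3 : i = J.c
    · subst h3; rw [verM_c]; simp [Finsupp.single_apply, Ne.symm hc]
    rw [verM_other J i h1 h2 h3]; simp [Finsupp.single_apply]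
  simp only [key]
  rw [Finset.sum_ite_eq']; simp

/-! ## Part V2: the three special coordinates, balanced exponents, and the fibres of the Veronese substitution -/

/-- Veronese-balanced exponents: no `Y_b`, and even total `Z, W`-degree. [folklore] -/
def VBal (x : σ →₀ ℕ) : Prop := x J.b = 0 ∧ (x J.a + x J.c) % 2 = 0

/-- Veronese images are balanced. [folklore] -/
theorem vbal_piT (L : σ →₀ ℕ) : VBal J (piT (verM J) L) := by
  unfold VBal
  rw [piT_verM_a, piT_verM_b, piT_verM_c]; omega

/-- The reduced exponent `x̂`: half the `Z, W`-degree on `a`, the coordinates `b, c` set to zero. [folklore] -/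
def vhat (x : σ →₀ ℕ) : σ →₀ ℕ := ofFun fun j => if j = J.a then (x J.a + x J.c) / 2 else if j = J.b ∨ j = J.c then 0 else x j

/-- The reduced exponent at `a`. [folklore] -/
theorem vhat_a (x : σ →₀ ℕ) : vhat J x J.a = (x J.a + x J.c) / 2 := by
  classical simp [vhat]

/-- The reduced exponent at `b`. [folklore] -/
theorem vhat_b (x : σ →₀ ℕ) : vhat J x J.b = 0 := by
  classical simp [vhat, J.hab.symm]

/-- The reduced exponent at `c`. [folklore] -/
theorem vhat_c (x : σ →₀ ℕ) : vhat J x J.c = 0 := by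
  classical simp [vhat, J.hac.symm]

/-- The reduced exponent elsewhere. [folklore] -/
theorem vhat_other (x : σ →₀ ℕ) (j : σ) (ha : j ≠ J.a) (hb : j ≠ J.b) (hc : j ≠ J.c) : vhat J x j = x j := by
  classical simp [vhat, ha, hb, hc]

/-- The letter multiset in the fibre of the Veronese substitution over `x` with `#β = k`:
`#α = (x a - k)/2, #β = k, #γ = (x c - k)/2`, other letters as in `x`. [folklore] -/
def VLof (x : σ →₀ ℕ) (k : ℕ) : σ →₀ ℕ :=
  ofFun fun j => if j = J.a then (x J.a - k) / 2 else if j = J.b then k else if j = J.c then (x J.c - k) / 2 else x j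

/-- The fibre element at `a`. [folklore] -/
theorem VLof_a (x : σ →₀ ℕ) (k : ℕ) : VLof J x k J.a = (x J.a - k) / 2 := by
  classical simp [VLof]

/-- The fibre element at `b`. [folklore] -/
theorem VLof_b (x : σ →₀ ℕ) (k : ℕ) : VLof J x k J.b = k := by
  classical simp [VLof, J.hab.symm]

/-- The fibre element at `c`. [folklore] -/
theorem VLof_c (x : σ →₀ ℕ) (k : ℕ) : VLof J x k J.c = (x J.c - k) / 2 := by
  classical simp [VLof, J.hac.symm, J.hbc.symm]

/-- The fibre element elsewhere. [folklore] -/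
theorem VLof_other (x : σ →₀ ℕ) (k : ℕ) (j : σ) (ha : j ≠ J.a) (hb : j ≠ J.b) (hc : j ≠ J.c) :
    VLof J x k j = x j := by
  classical simp [VLof, ha, hb, hc]

/-- The admissible range of `k = #β` in the fibre over `x`: `k ≤ x a`, `k ≤ x c`, `k ≡ x a (mod 2)`. [folklore] -/
def VKR (x : σ →₀ ℕ) : Finset ℕ := (Finset.range (min (x J.a) (x J.c) + 1)).filter fun k => k % 2 = x J.a % 2

omit [Fintype σ] [DecidableEq σ] in
/-- Membership in the admissible range. [folklore] -/
theorem mem_VKR (x : σ →₀ ℕ) (k : ℕ) : k ∈ VKR J x ↔ k ≤ x J.a ∧ k ≤ x J.c ∧ k % 2 = x J.a % 2 := by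
  unfold VKR; rw [Finset.mem_filter, Finset.mem_range]; omega

/-- (F1) Every preimage of `x` is a `VLof x k` with `k` admissible. [folklore] -/
theorem eq_VLof_of_piT (L x : σ →₀ ℕ) (h : piT (verM J) L = x) : L J.b ∈ VKR J x ∧ L = VLof J x (L J.b) := by
  have ha := piT_verM_a J L; have hb := piT_verM_b J L; have hc := piT_verM_c J L
  rw [h] at ha hb hc
  refine ⟨(mem_VKR J x _).2 ⟨by omega, by omega, by omega⟩, ?_⟩
  ext j
  by_cases hja : j = J.a
  · subst hja; rw [VLof_a]; omega
  by_cases hjb : j = J.b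
  · subst hjb; rw [VLof_b]
  by_cases hjc : j = J.c
  · subst hjc; rw [VLof_c]; omega
  rw [VLof_other J x _ j hja hjb hjc, ← h, piT_verM_other J L j hja hjb hjc]

/-- (F2) Every admissible `VLof x k` lies in the fibre over a balanced `x`. [folklore] -/
theorem piT_VLof (x : σ →₀ ℕ) (hx : VBal J x) (k : ℕ) (hk : k ∈ VKR J x) : piT (verM J) (VLof J x k) = x := by
  rw [mem_VKR] at hk
  unfold VBal at hx
  ext j
  by_cases hja : j = J.a
  · subst hja; rw [piT_verM_a, VLof_a, VLof_b]; omega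
  by_cases hjb : j = J.b
  · subst hjb; rw [piT_verM_b]; omega
  by_cases hjc : j = J.c
  · subst hjc; rw [piT_verM_c, VLof_b, VLof_c]; omega
  rw [piT_verM_other J _ j hja hjb hjc, VLof_other J x k j hja hjb hjc]

/-- (F4) The degree is constant along the fibre: `deg (VLof x k) = deg x̂`. [folklore] -/
theorem deg_VLof (x : σ →₀ ℕ) (hx : VBal J x) (k : ℕ) (hk : k ∈ VKR J x) : deg (VLof J x k) = deg (vhat J x) := by
  rw [mem_VKR] at hk
  unfold VBal at hx
  rw [deg_eq_sum, deg_eq_sum, R6b.sum_three_split J, R6b.sum_three_split J, VLof_a, VLof_b, VLof_c, vhat_a, vhat_b, vhat_c]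
  have : ∑ j ∈ R6b.rest J, (VLof J x k) j = ∑ j ∈ R6b.rest J, (vhat J x) j := by
    refine Finset.sum_congr rfl fun j hj => ?_
    rw [R6b.mem_rest] at hj
    rw [VLof_other J x k j hj.1 hj.2.1 hj.2.2, vhat_other J x j hj.1 hj.2.1 hj.2.2]
  rw [this]; omega

/-- The degree of the reduced exponent. [folklore] -/
theorem deg_vhat (x : σ →₀ ℕ) : deg (vhat J x) = (∑ j ∈ R6b.rest J, x j) + (x J.a + x J.c) / 2 := by
  rw [deg_eq_sum, R6b.sum_three_split J, vhat_a, vhat_b, vhat_c, add_zero, add_zero]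
  congr 1
  refine Finset.sum_congr rfl fun j hj => ?_
  rw [R6b.mem_rest] at hj
  rw [vhat_other J x j hj.1 hj.2.1 hj.2.2]

/-- The full degree of a balanced exponent in terms of the reduced one. [folklore] -/
theorem deg_eq_deg_vhat_add (x : σ →₀ ℕ) (hx : VBal J x) : deg x = deg (vhat J x) + (x J.a + x J.c) / 2 := by
  unfold VBal at hx
  rw [deg_vhat, deg_eq_sum, R6b.sum_three_split J]; omega

/-- (F5) Multinomial regrouping along the fibre:
`n!/(((x_a-k)/2)! k! ((x_c-k)/2)! M!) = n!/(h! M!) · C(h, (x_c+k)/2) · C((x_c+k)/2, k)`, `h = (x_a+x_c)/2`. [folklore] -/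
theorem multinomial_VLof (x : σ →₀ ℕ) (hx : VBal J x) (k : ℕ) (hk : k ∈ VKR J x) :
    (VLof J x k).multinomial = (vhat J x).multinomial *
      (((x J.a + x J.c) / 2).choose ((x J.c + k) / 2) * ((x J.c + k) / 2).choose k) := by
  have hk' := (mem_VKR J x k).1 hk
  have hx' : x J.b = 0 ∧ (x J.a + x J.c) % 2 = 0 := hx
  have hdeg := deg_VLof J x hx k hk
  rw [deg_eq_sum, deg_eq_sum] at hdeg
  have sL := Nat.multinomial_spec (Finset.univ : Finset σ) (VLof J x k)
  have sX := Nat.multinomial_spec (Finset.univ : Finset σ) (vhat J x)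
  rw [← multinomial_univ] at sL sX
  rw [hdeg, ← sX] at sL
  -- the factorial identity
  have P : (∏ j, ((VLof J x k) j).factorial) *
      (((x J.a + x J.c) / 2).choose ((x J.c + k) / 2) * ((x J.c + k) / 2).choose k) =
      ∏ j, ((vhat J x) j).factorial := by
    rw [R6b.prod_three_split J, R6b.prod_three_split J, VLof_a, VLof_b, VLof_c, vhat_a, vhat_b, vhat_c]
    have hr : ∏ j ∈ R6b.rest J, ((VLof J x k) j).factorial = ∏ j ∈ R6b.rest J, ((vhat J x) j).factorial := by
      refine Finset.prod_congr rfl fun j hj => ?_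
      rw [R6b.mem_rest] at hj
      rw [VLof_other J x k j hj.1 hj.2.1 hj.2.2, vhat_other J x j hj.1 hj.2.1 hj.2.2]
    rw [hr, Nat.factorial_zero, mul_one]
    set h : ℕ := (x J.a + x J.c) / 2 with hh
    set d : ℕ := (x J.c + k) / 2 with hd
    have hdh : d ≤ h := by omega
    have hkd : k ≤ d := by omega
    have e1 : h - d = (x J.a - k) / 2 := by omega
    have e2 : d - k = (x J.c - k) / 2 := by omega
    have h1 : h.choose d * d.factorial * (h - d).factorial = h.factorial := Nat.choose_mul_factorial_mul_factorial hdh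
    have h2 : d.choose k * k.factorial * (d - k).factorial = d.factorial := Nat.choose_mul_factorial_mul_factorial hkd
    rw [← e1, ← e2, ← h1, ← h2]; ring
  have hpos : 0 < ∏ j, ((VLof J x k) j).factorial := Finset.prod_pos fun j _ => Nat.factorial_pos _
  apply Nat.eq_of_mul_eq_mul_left hpos
  rw [sL, ← P]; ring

end R6c
end Summit.ValiantsHypothesis.ValiantsHypothesis.Theorems.NewtonUnitEquations.TwoProducts.PermutationType

end
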